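import Summits.AtomisticToContinuum.Crystallization.Theorems.ChartedZeroExcessLayeredLatticeLiouvilleZZZYF

/-!
# ChartedZeroExcess · LayeredLatticeLiouville ZZZYG (lens-2 g92 NODE 92 «SoftHardDichotomy») — THE ENERGETIC RESIDUAL RE-BASED ON THE OFF-TUBE GAP
# ABOUT THE MINIMISER (OGᴹ′) AND SPLIT BY LOCAL RIGIDITY: SPECIAL = SOFT (slowly co-rotated) cores, GENERIC = HARD (one localised non-rigid jump).
Docket `stmt-AtomisticToContinuum-26636` (crux `ChartedZeroExcessLayered`), W2 line; residual of record after g91 (critic r1622): (X1ᴸ′) `LabelTubeConvexityP`,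
(X2ᴸ′) `LabelLoadedTubeAprioriP`, (DWᴹ′) `DeficitWellMinP`, door `mildCoherentMoatCorePG_W2f` (tree ZZZYF).  THIS FILE (all PROVED, 0 sorry):
* BLOCKER = the energetic leaf (DWᴹ′).  The door consumes it ONLY off the outer tube (`minInLabelTubeP_of_gap` ∘ `offTubeGapP_of_rigidity`); its in-tube
  half is never read.  So the residual is RE-BASED on the weaker **(OGᴹ) `OffTubeGapMinP … g₀`** = tree ZZZRA's (OGᴸ) `OffTubeGapP` with (DWᴹ)'s
  minimising clause: OFF the outer tube, the clamped energy of the core exceeds that of the MINIMISING critical tame inner-tube filling by `g₀`.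
  WEAKER-THAN certificates: `OffTubeGapMinP.of_gap` ((OGᴸ) ⟹ (OGᴹ)), `offTubeGapMinP_of_deficitWellMin` ((RDᴸ)(D₀) ∧ (DWᴹ)(cE, σ₀) ⟹ (OGᴹ)(cE·D₀ − σ₀)),
  `exists_offTubeGapMinP_sigma_of_deficitWellMin` ((DWᴹ)(σ)(cE > 0, 0) ⟹ ∃ g₀ > 0, (OGᴹ)(σ)(g₀) at the record radii, (RGᴸ)/(TGᴸ) discharged in tree).
* NEW DOOR W2g: `mildCoherentMoatCorePG_W2g : ϑc ≤ 5·10⁻¹² ∧ (X1ᴸ′)(lam > 0) ∧ (X2ᴸ′) ∧ (OGᴹ′)(g₀ > 0) ⟹ [MCMC♮](ϑc)` (`_W2g_sigma` for every `σ > 21/25`),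
  `exists_mildCoherentMoatCorePG_W2g`, and (an `example`, lane edition; the node's `mildCoherentMoatCorePG_W2f_via_gap`) the door of record RE-DERIVED through W2g (old residual ⟹ new residual ⟹ door).
* THE LENS SPLIT (structural dichotomy special/generic, ONE layer beneath (OGᴹ)): `IsSoftAbout Rd τ y₀ y xf` — the core is LOCALLY RIGID ABOUT `y` at
  pair range `Rd` up to `τ` modulo a proper rotation PER SITE (`∃ V, det V i = 1, ∀ pairs dist(y₀ i, y₀ j) ≤ Rd: ‖(xf j − xf i) − V i (y j − y i)‖ ≤ τ`);
  **(OGˢ) `OffTubeSoftGapMinP … Rd τ g₀`** = (OGᴹ) on SOFT off-tube cores (slowly bent / co-rotated grains pinned at the registered rim: a BENDING regime),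
  **(OGʰ) `OffTubeHardGapMinP … Rd τ g₀`** = (OGᴹ) on HARD ones (`¬ IsSoftAbout`: for EVERY proper field some `Rd`-pair jumps by `> τ` — a LOCALISED DEFECT,
  `exists_jump_of_not_isSoftAbout`).  EXACT split `offTubeGapMinP_iff_softHard : (OGᴹ) ↔ (OGˢ) ∧ (OGʰ)` (every `Rd`, `τ`); door `mildCoherentMoatCorePG_W2g_softHard`.
  Scale certificate `offTubeSoftGapMinP_of_small`: under a deficit floor (RDᴸ)(D₀) the soft class is EMPTY while `N²τ² < D₀` (`N` the packing count of the core),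
  so (OGˢ) carries content exactly from `τ ≈ √D₀/N` on — the split is not a threshold costume: both classes are non-empty for every larger `τ`
  (soft: grains co-rotated by a slowly varying field; hard: a single over-stretched pair), and `isSoftAbout_self` (the filling is soft about itself).
0 sorry · import = tree ZZZYF only · 4 defs (Prop-valued, explicit binders as the tree's leaves) · no instances/notation/options · axioms standard. [g92]
-/

noncomputable section
open scoped BigOperators Classical InnerProductSpace RealInnerProductSpace
open MeasureTheory Set Metric Filter Topology
open Literature.Geometry.DiscreteGeometry (IsTwoShellGoodSet)
open Literature.MathematicalPhysics.StatisticalMechanics (lennardJones card_le_of_separated_of_dist_le)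

namespace Summit.AtomisticToContinuum.Crystallization.Theorems.ChartedZeroExcessLayeredLatticeLiouville

open Summit.AtomisticToContinuum.Crystallization.Theorems.ChartedPlanarOrderRigidityDoor (E3 IsClean)
open Summit.AtomisticToContinuum.Crystallization.Theorems.ChartedPlanarOrderDensityDichotomy (μS IsSep)
open Summit.AtomisticToContinuum.Crystallization.Theorems.ChartedPlanarOrderCleanScaleP (IsCleanP IsDoorSetP)
open Summit.AtomisticToContinuum.Crystallization.Theorems.ChartedPlanarOrderMesoCut (LayeredHom EnvClose)
open Summit.AtomisticToContinuum.Crystallization.Theorems.ChartedPlanarOrderDoorLayeredOsc (IsTwoShellAffineGood)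

section SoftClass

variable {n : ℕ}

/-- ★★ **`IsSoftAbout Rd τ y₀ y xf` — THE SPECIAL CLASS: the core `xf` is LOCALLY RIGID ABOUT the filling `y` at pair range `Rd` up to `τ`, modulo a proper
rotation chosen independently AT EVERY SITE** (`y₀` = the label image, which carries the pair set, as in `coreDeficit`).  Soft cores differ from `y` only by
slowly varying co-rotations (bending); `¬ IsSoftAbout` = for every proper rotation field some `Rd`-pair's relative displacement misses the co-rotated one by
`> τ` = a LOCALISED NON-RIGID JUMP (the GENERIC class).  [this file, g92 · kinematic, no energy] -/
def IsSoftAbout (Rd τ : ℝ) (y₀ y xf : Fin n → E3) : Prop :=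
  ∃ V : Fin n → (E3 ≃ₗᵢ[ℝ] E3), (∀ i, LinearMap.det ((V i).toLinearEquiv : E3 →ₗ[ℝ] E3) = 1) ∧
    ∀ i j, dist (y₀ i) (y₀ j) ≤ Rd → ‖(xf j - xf i) - V i (y j - y i)‖ ≤ τ

/-- the soft class grows with the tolerance. [formal bookkeeping] -/
theorem IsSoftAbout.mono {Rd τ τ' : ℝ} {y₀ y xf : Fin n → E3} (h : IsSoftAbout Rd τ y₀ y xf) (hτ : τ ≤ τ') : IsSoftAbout Rd τ' y₀ y xf := by
  obtain ⟨V, hV, hb⟩ := h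
  exact ⟨V, hV, fun i j hij => (hb i j hij).trans hτ⟩

/-- NON-VACUITY GUARD: the filling is soft about itself at every `τ ≥ 0` (identity field) — the special class is never empty. [formal bookkeeping] -/
theorem isSoftAbout_self {Rd τ : ℝ} {y₀ y : Fin n → E3} (hτ : 0 ≤ τ) : IsSoftAbout Rd τ y₀ y y :=
  ⟨fun _ => LinearIsometryEquiv.refl ℝ E3, fun _ => det_refl_E3_eq_one, fun i j _ => by simpa using hτ⟩

/-- THE GENERIC CLASS UNFOLDED: a hard core shows, against EVERY proper rotation field, an `Rd`-pair whose relative displacement jumps by more than `τ`. -/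
theorem exists_jump_of_not_isSoftAbout {Rd τ : ℝ} {y₀ y xf : Fin n → E3} (h : ¬ IsSoftAbout Rd τ y₀ y xf) (V : Fin n → (E3 ≃ₗᵢ[ℝ] E3))
    (hV : ∀ i, LinearMap.det ((V i).toLinearEquiv : E3 →ₗ[ℝ] E3) = 1) : ∃ i j, dist (y₀ i) (y₀ j) ≤ Rd ∧ τ < ‖(xf j - xf i) - V i (y j - y i)‖ := by
  by_contra hc
  push Not at hc
  exact h ⟨V, hV, fun i j hij => hc i j hij⟩

/-- ★ **SOFT ⟹ SMALL DEFICIT (PROVED)**: the witnessing field has `coreDeficit ≤ n²·τ²` (each of the `≤ n²` pair terms is `≤ τ²`). [this file, g92] -/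
theorem coreDeficit_le_of_isSoftAbout {Rd τ : ℝ} {y₀ y xf : Fin n → E3} (h : IsSoftAbout Rd τ y₀ y xf) :
    ∃ V : Fin n → (E3 ≃ₗᵢ[ℝ] E3), (∀ i, LinearMap.det ((V i).toLinearEquiv : E3 →ₗ[ℝ] E3) = 1) ∧ coreDeficit Rd y₀ y xf V ≤ (n : ℝ) ^ 2 * τ ^ 2 := by
  obtain ⟨V, hV, hb⟩ := h
  refine ⟨V, hV, ?_⟩
  have hterm : ∀ i j, (if dist (y₀ i) (y₀ j) ≤ Rd then ‖(xf j - xf i) - V i (y j - y i)‖ ^ 2 else 0) ≤ τ ^ 2 := by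
    intro i j
    split_ifs with hij
    · exact pow_le_pow_left₀ (norm_nonneg _) (hb i j hij) 2
    · positivity
  calc coreDeficit Rd y₀ y xf V = ∑ i, ∑ j, (if dist (y₀ i) (y₀ j) ≤ Rd then ‖(xf j - xf i) - V i (y j - y i)‖ ^ 2 else 0) := rfl
    _ ≤ ∑ _i : Fin n, ∑ _j : Fin n, τ ^ 2 := Finset.sum_le_sum fun i _ => Finset.sum_le_sum fun j _ => hterm i j
    _ = (n : ℝ) ^ 2 * τ ^ 2 := by simp only [Finset.sum_const, Finset.card_univ, Fintype.card_fin]; ring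

end SoftClass

section Residual

/-- ★★★★ **(OGᴹ) «OffTubeGapMinP … Rg sb dI dB sb₁ dI₁ dB₁ g₀ …» — THE RE-BASED ENERGETIC RESIDUAL: OFF THE OUTER BOND TUBE, THE CLAMPED ENERGY EXCEEDS
THAT OF THE MINIMISING CRITICAL TAME INNER-TUBE FILLING BY `g₀`.**  Verbatim tree ZZZRA's (OGᴸ) `OffTubeGapP` with ONE MORE hypothesis on `y` (the last
one): `y` MINIMISES `clampedEnergy (S ∖ core)` over the inner tube — exactly the clause by which tree ZZZTA's (DWᴹ) weakens (DWᴸ); under (XRᴸ) ∧ (X1ᴸ)(lam ≥ 0)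
every critical inner-tube filling is that minimiser (`offTubeGapP_of_min`).  WEAKER than the residual of record (DWᴹ′) (`exists_offTubeGapMinP_sigma_of_deficitWellMin`)
and than (OGᴸ) (`OffTubeGapMinP.of_gap`); ANTITONE in `g₀` (`OffTubeGapMinP.of_le`).  [ENERGETIC · energy VALUES only · UNDECIDED · this file, g92] -/
def OffTubeGapMinP (ϑc ϑ ϑp r rΘ q rsh ρ rm σ ϑr Rs ε rI ℓ Rg sb dI dB sb₁ dI₁ dB₁ g₀ aHi Λ θ s : ℝ) : Prop :=
  ∀ δ : ℝ, 0 < δ → ∀ a : ℝ, 0 < a →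
    ∀ S : Set E3, IsDoorSetP aHi δ S → (∀ z : E3, Summable fun y : S => lennardJones (dist z (y : E3))) →
      (∀ p ∈ S, IsTwoShellAffineGood θ S p) →
        ∀ (L : E3 ≃L[ℝ] E3) (w : ℤ → E3), IsEquilChart a s Λ L w →
          ∀ (x₀ : E3) (K : Set E3), K ⊆ S → (∀ k ∈ K, dist k x₀ ≤ q) →
            IsTameOn ϑp S (LayeredHom (L : E3 →L[ℝ] E3) w) (coreOf S K rm) →
              IsTameOn ϑc S (LayeredHom (L : E3 →L[ℝ] E3) w) (moatIn S K r (r + rsh)) →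
                ∀ (n : ℕ) (xf : Fin n → E3), Function.Injective xf → Set.range xf = coreOf S K ρ →
                  ∀ (L' : E3 →L[ℝ] E3) (w' : ℤ → E3) (U : E3 ≃ₗᵢ[ℝ] E3) (t : E3),
                    IsCoolShadowCrystal σ ϑr Rs ε r rI ℓ S K (LayeredHom (L : E3 →L[ℝ] E3) w) L' w' U t →
                      ∀ lab : E3 → E3, IsBondLabel ε rΘ ℓ S K (placedCrystal L' w' U t) lab →
                        xf ∉ bondTube (S \ coreOf S K ρ) Rg sb dI dB (fun i => lab (xf i)) →
                          ∀ y ∈ bondTube (S \ coreOf S K ρ) Rg sb₁ dI₁ dB₁ (fun i => lab (xf i)),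
                            Function.Injective y → Disjoint (Set.range y) (S \ coreOf S K ρ) →
                              HasFDerivAt (fun z : Fin n → E3 => clampedEnergy (S \ coreOf S K ρ) z) (0 : (Fin n → E3) →L[ℝ] ℝ) y →
                                (∀ i, IsTameStar ϑ ((S \ coreOf S K ρ) ∪ Set.range y) (LayeredHom (L : E3 →L[ℝ] E3) w) (y i)) →
                                (∀ z ∈ bondTube (S \ coreOf S K ρ) Rg sb₁ dI₁ dB₁ (fun i => lab (xf i)),
                                    clampedEnergy (S \ coreOf S K ρ) y ≤ clampedEnergy (S \ coreOf S K ρ) z) →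
                                  clampedEnergy (S \ coreOf S K ρ) y + g₀ ≤ clampedEnergy (S \ coreOf S K ρ) xf

/-- ★★★ **(OGˢ) «OffTubeSoftGapMinP … Rd τ g₀ …» — THE SPECIAL LEAF: (OGᴹ) restricted to SOFT off-tube cores (`IsSoftAbout Rd τ (lab ∘ xf) y xf`:
locally rigid about the minimiser up to `τ` at pair range `Rd` — slowly co-rotated / bent grains pinned at the registered rim).**  EMPTY below the rigidity
scale (`offTubeSoftGapMinP_of_small`); above it a BENDING problem (geometric rigidity cell by cell + the rotation-gradient energy; the pair potential reads bond
LENGTHS only, which soft fields change to second order).  [SPECIAL · ENERGETIC · ATTACKABLE · this file, g92] -/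
def OffTubeSoftGapMinP (ϑc ϑ ϑp r rΘ q rsh ρ rm σ ϑr Rs ε rI ℓ Rg sb dI dB sb₁ dI₁ dB₁ Rd τ g₀ aHi Λ θ s : ℝ) : Prop :=
  ∀ δ : ℝ, 0 < δ → ∀ a : ℝ, 0 < a →
    ∀ S : Set E3, IsDoorSetP aHi δ S → (∀ z : E3, Summable fun y : S => lennardJones (dist z (y : E3))) →
      (∀ p ∈ S, IsTwoShellAffineGood θ S p) →
        ∀ (L : E3 ≃L[ℝ] E3) (w : ℤ → E3), IsEquilChart a s Λ L w →
          ∀ (x₀ : E3) (K : Set E3), K ⊆ S → (∀ k ∈ K, dist k x₀ ≤ q) →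
            IsTameOn ϑp S (LayeredHom (L : E3 →L[ℝ] E3) w) (coreOf S K rm) →
              IsTameOn ϑc S (LayeredHom (L : E3 →L[ℝ] E3) w) (moatIn S K r (r + rsh)) →
                ∀ (n : ℕ) (xf : Fin n → E3), Function.Injective xf → Set.range xf = coreOf S K ρ →
                  ∀ (L' : E3 →L[ℝ] E3) (w' : ℤ → E3) (U : E3 ≃ₗᵢ[ℝ] E3) (t : E3),
                    IsCoolShadowCrystal σ ϑr Rs ε r rI ℓ S K (LayeredHom (L : E3 →L[ℝ] E3) w) L' w' U t →
                      ∀ lab : E3 → E3, IsBondLabel ε rΘ ℓ S K (placedCrystal L' w' U t) lab →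
                        xf ∉ bondTube (S \ coreOf S K ρ) Rg sb dI dB (fun i => lab (xf i)) →
                          ∀ y ∈ bondTube (S \ coreOf S K ρ) Rg sb₁ dI₁ dB₁ (fun i => lab (xf i)),
                            Function.Injective y → Disjoint (Set.range y) (S \ coreOf S K ρ) →
                              HasFDerivAt (fun z : Fin n → E3 => clampedEnergy (S \ coreOf S K ρ) z) (0 : (Fin n → E3) →L[ℝ] ℝ) y →
                                (∀ i, IsTameStar ϑ ((S \ coreOf S K ρ) ∪ Set.range y) (LayeredHom (L : E3 →L[ℝ] E3) w) (y i)) →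
                                (∀ z ∈ bondTube (S \ coreOf S K ρ) Rg sb₁ dI₁ dB₁ (fun i => lab (xf i)),
                                    clampedEnergy (S \ coreOf S K ρ) y ≤ clampedEnergy (S \ coreOf S K ρ) z) →
                                  IsSoftAbout Rd τ (fun i => lab (xf i)) y xf →
                                    clampedEnergy (S \ coreOf S K ρ) y + g₀ ≤ clampedEnergy (S \ coreOf S K ρ) xf

/-- ★★★ **(OGʰ) «OffTubeHardGapMinP … Rd τ g₀ …» — THE GENERIC LEAF: (OGᴹ) restricted to HARD off-tube cores (`¬ IsSoftAbout …`: against every proper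
rotation field some `Rd`-pair jumps by `> τ` — a LOCALISED tame defect of amplitude between `τ` and the tameness `1/10`).**  A calibrated local-excess problem
(the defect star pays, the rest is a near-minimiser).  [GENERIC · ENERGETIC · IDEA-NEEDED / INSTRUMENTABLE «OffTubeGap-T/hard» · this file, g92] -/
def OffTubeHardGapMinP (ϑc ϑ ϑp r rΘ q rsh ρ rm σ ϑr Rs ε rI ℓ Rg sb dI dB sb₁ dI₁ dB₁ Rd τ g₀ aHi Λ θ s : ℝ) : Prop :=
  ∀ δ : ℝ, 0 < δ → ∀ a : ℝ, 0 < a →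
    ∀ S : Set E3, IsDoorSetP aHi δ S → (∀ z : E3, Summable fun y : S => lennardJones (dist z (y : E3))) →
      (∀ p ∈ S, IsTwoShellAffineGood θ S p) →
        ∀ (L : E3 ≃L[ℝ] E3) (w : ℤ → E3), IsEquilChart a s Λ L w →
          ∀ (x₀ : E3) (K : Set E3), K ⊆ S → (∀ k ∈ K, dist k x₀ ≤ q) →
            IsTameOn ϑp S (LayeredHom (L : E3 →L[ℝ] E3) w) (coreOf S K rm) →
              IsTameOn ϑc S (LayeredHom (L : E3 →L[ℝ] E3) w) (moatIn S K r (r + rsh)) →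
                ∀ (n : ℕ) (xf : Fin n → E3), Function.Injective xf → Set.range xf = coreOf S K ρ →
                  ∀ (L' : E3 →L[ℝ] E3) (w' : ℤ → E3) (U : E3 ≃ₗᵢ[ℝ] E3) (t : E3),
                    IsCoolShadowCrystal σ ϑr Rs ε r rI ℓ S K (LayeredHom (L : E3 →L[ℝ] E3) w) L' w' U t →
                      ∀ lab : E3 → E3, IsBondLabel ε rΘ ℓ S K (placedCrystal L' w' U t) lab →
                        xf ∉ bondTube (S \ coreOf S K ρ) Rg sb dI dB (fun i => lab (xf i)) →
                          ∀ y ∈ bondTube (S \ coreOf S K ρ) Rg sb₁ dI₁ dB₁ (fun i => lab (xf i)),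
                            Function.Injective y → Disjoint (Set.range y) (S \ coreOf S K ρ) →
                              HasFDerivAt (fun z : Fin n → E3 => clampedEnergy (S \ coreOf S K ρ) z) (0 : (Fin n → E3) →L[ℝ] ℝ) y →
                                (∀ i, IsTameStar ϑ ((S \ coreOf S K ρ) ∪ Set.range y) (LayeredHom (L : E3 →L[ℝ] E3) w) (y i)) →
                                (∀ z ∈ bondTube (S \ coreOf S K ρ) Rg sb₁ dI₁ dB₁ (fun i => lab (xf i)),
                                    clampedEnergy (S \ coreOf S K ρ) y ≤ clampedEnergy (S \ coreOf S K ρ) z) →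
                                  ¬ IsSoftAbout Rd τ (fun i => lab (xf i)) y xf →
                                    clampedEnergy (S \ coreOf S K ρ) y + g₀ ≤ clampedEnergy (S \ coreOf S K ρ) xf

variable {ϑc ϑ ϑp r rΘ q rsh ρ rm σ ϑr Rs ε rI ℓ Rg sb dI dB sb₁ dI₁ dB₁ Rd τ g₀ g₀' aHi Λ θ s : ℝ}

/-- (OGᴹ) is antitone in the gap. [formal bookkeeping] -/
theorem OffTubeGapMinP.of_le (hg : g₀' ≤ g₀) (h : OffTubeGapMinP ϑc ϑ ϑp r rΘ q rsh ρ rm σ ϑr Rs ε rI ℓ Rg sb dI dB sb₁ dI₁ dB₁ g₀ aHi Λ θ s) :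
    OffTubeGapMinP ϑc ϑ ϑp r rΘ q rsh ρ rm σ ϑr Rs ε rI ℓ Rg sb dI dB sb₁ dI₁ dB₁ g₀' aHi Λ θ s := by
  intro δ hδ a ha S hS hsum hgood L w hLw x₀ K hKS hKq hmild hcool n xf hxf hrange L' w' U t hC lab hlab hoff y hyT hyinj hydisj hcrit htame hmin
  have := h δ hδ a ha S hS hsum hgood L w hLw x₀ K hKS hKq hmild hcool n xf hxf hrange L' w' U t hC lab hlab hoff y hyT hyinj hydisj hcrit htame hmin
  linarith

/-- WEAKER-THAN CERTIFICATE: (OGᴸ) ⟹ (OGᴹ) (drop the minimising clause). [formal bookkeeping] -/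
theorem OffTubeGapMinP.of_gap (h : OffTubeGapP ϑc ϑ ϑp r rΘ q rsh ρ rm σ ϑr Rs ε rI ℓ Rg sb dI dB sb₁ dI₁ dB₁ g₀ aHi Λ θ s) :
    OffTubeGapMinP ϑc ϑ ϑp r rΘ q rsh ρ rm σ ϑr Rs ε rI ℓ Rg sb dI dB sb₁ dI₁ dB₁ g₀ aHi Λ θ s := by
  intro δ hδ a ha S hS hsum hgood L w hLw x₀ K hKS hKq hmild hcool n xf hxf hrange L' w' U t hC lab hlab hoff y hyT hyinj hydisj hcrit htame _
  exact h δ hδ a ha S hS hsum hgood L w hLw x₀ K hKS hKq hmild hcool n xf hxf hrange L' w' U t hC lab hlab hoff y hyT hyinj hydisj hcrit htame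

/-- ★★★ **THE LENS SPLIT IS EXACT (PROVED): (OGᴹ)(g₀) ↔ (OGˢ)(Rd, τ, g₀) ∧ (OGʰ)(Rd, τ, g₀)** for every pair range `Rd` and tolerance `τ` — a core is soft or
it is hard.  The glue of NODE 92. [this file, g92] -/
theorem offTubeGapMinP_iff_softHard : OffTubeGapMinP ϑc ϑ ϑp r rΘ q rsh ρ rm σ ϑr Rs ε rI ℓ Rg sb dI dB sb₁ dI₁ dB₁ g₀ aHi Λ θ s ↔
    OffTubeSoftGapMinP ϑc ϑ ϑp r rΘ q rsh ρ rm σ ϑr Rs ε rI ℓ Rg sb dI dB sb₁ dI₁ dB₁ Rd τ g₀ aHi Λ θ s ∧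
      OffTubeHardGapMinP ϑc ϑ ϑp r rΘ q rsh ρ rm σ ϑr Rs ε rI ℓ Rg sb dI dB sb₁ dI₁ dB₁ Rd τ g₀ aHi Λ θ s := by
  refine ⟨fun h => ⟨?_, ?_⟩, fun h => ?_⟩
  · intro δ hδ a ha S hS hsum hgood L w hLw x₀ K hKS hKq hmild hcool n xf hxf hrange L' w' U t hC lab hlab hoff y hyT hyinj hydisj hcrit htame hmin _
    exact h δ hδ a ha S hS hsum hgood L w hLw x₀ K hKS hKq hmild hcool n xf hxf hrange L' w' U t hC lab hlab hoff y hyT hyinj hydisj hcrit htame hmin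
  · intro δ hδ a ha S hS hsum hgood L w hLw x₀ K hKS hKq hmild hcool n xf hxf hrange L' w' U t hC lab hlab hoff y hyT hyinj hydisj hcrit htame hmin _
    exact h δ hδ a ha S hS hsum hgood L w hLw x₀ K hKS hKq hmild hcool n xf hxf hrange L' w' U t hC lab hlab hoff y hyT hyinj hydisj hcrit htame hmin
  · intro δ hδ a ha S hS hsum hgood L w hLw x₀ K hKS hKq hmild hcool n xf hxf hrange L' w' U t hC lab hlab hoff y hyT hyinj hydisj hcrit htame hmin
    by_cases hs : IsSoftAbout Rd τ (fun i => lab (xf i)) y xf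
    · exact h.1 δ hδ a ha S hS hsum hgood L w hLw x₀ K hKS hKq hmild hcool n xf hxf hrange L' w' U t hC lab hlab hoff y hyT hyinj hydisj hcrit htame
        hmin hs
    · exact h.2 δ hδ a ha S hS hsum hgood L w hLw x₀ K hKS hKq hmild hcool n xf hxf hrange L' w' U t hC lab hlab hoff y hyT hyinj hydisj hcrit htame
        hmin hs

/-- ★★ **THE SOFT CLASS IS EMPTY BELOW THE RIGIDITY SCALE (PROVED)**: under a deficit floor (RDᴸ)(Rd, D₀) off the tube (tree ZZZS `OffTubeDeficitFloorP`; at the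
record dials = (RGᴸ′)·(TGᴸ′), both PROVED in tree), `aHi ≤ 1`, `0 ≤ ρ + q`, every tolerance with `N²·τ² < D₀` (`N = (2(ρ+q)/(27/32) + 1)³ ≥ n`, `card_core_le`)
makes (OGˢ)(Rd, τ, g₀) hold VACUOUSLY for every `g₀`: a soft core would have deficit `≤ n²τ² < D₀` (`coreDeficit_le_of_isSoftAbout`).  So the split has
content exactly from `τ ≈ √D₀ / N` on, where slowly bent grains enter the soft class. [this file, g92] -/
theorem offTubeSoftGapMinP_of_small {D₀ : ℝ} (haHi : aHi ≤ 1) (hρq : 0 ≤ ρ + q)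
    (hsmall : ((2 * (ρ + q) / (27 / 32) + 1) ^ 3) ^ 2 * τ ^ 2 < D₀)
    (hRD : OffTubeDeficitFloorP ϑc ϑp r rΘ q rsh ρ rm σ ϑr Rs ε rI ℓ Rg sb dI dB sb₁ dI₁ dB₁ Rd D₀ aHi Λ θ s) :
    OffTubeSoftGapMinP ϑc ϑ ϑp r rΘ q rsh ρ rm σ ϑr Rs ε rI ℓ Rg sb dI dB sb₁ dI₁ dB₁ Rd τ g₀ aHi Λ θ s := by
  intro δ hδ a ha S hS hsum hgood L w hLw x₀ K hKS hKq hmild hcool n xf hxf hrange L' w' U t hC lab hlab hoff y hyT hyinj hydisj hcrit htame hmin hsoft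
  exfalso
  obtain ⟨V, hV, hD⟩ := coreDeficit_le_of_isSoftAbout hsoft
  have hfloor := hRD δ hδ a ha S hS hsum hgood L w hLw x₀ K hKS hKq hmild hcool n xf hxf hrange L' w' U t hC lab hlab hoff y hyT V hV
  have hn : (n : ℝ) ≤ (2 * (ρ + q) / (27 / 32) + 1) ^ 3 := card_core_le (by norm_num) (isSep_of_isDoorSetP haHi hS) hKq hρq hxf hrange
  have hn2 : (n : ℝ) ^ 2 ≤ ((2 * (ρ + q) / (27 / 32) + 1) ^ 3) ^ 2 := pow_le_pow_left₀ n.cast_nonneg hn 2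
  nlinarith [mul_le_mul_of_nonneg_right hn2 (sq_nonneg τ)]

end Residual

section Glue

/-- ★★★ **(XRᴸ) ∧ (X1ᴸ)(lam ≥ 0) ∧ (OGᴹ) ⟹ (OGᴸ) on nested tubes (PROVED)** — the Min-clause is discharged exactly as in tree ZZZT `deficitWellP_of_min`: a
critical filling of the inner tube lies in the outer tube, (X1ᴸ) at it has `φ = 0` (`HasFDerivAt.unique`), so it minimises over the outer ⊇ inner tube. [this file, g92] -/
theorem offTubeGapP_of_min {ϑc ϑ ϑ₀ ϑ₁ ϑp r rΘ q rsh ρ rm σ ϑr Rs ε rI ℓ Rg sb dI dB sb₁ dI₁ dB₁ lam g₀ aHi Λ θ s : ℝ} (hlam : 0 ≤ lam)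
    (hsb : sb₁ ≤ sb) (hdI : dI₁ ≤ dI) (hdB : dB₁ ≤ dB)
    (hR : LabelTubeReferenceP ϑc ϑ₁ ϑp r rΘ q rsh ρ rm σ ϑr Rs ε rI ℓ ϑ₀ Rg sb dI dB aHi Λ θ s)
    (hX1 : LabelTubeConvexityP ϑc ϑ₁ ϑp r rΘ q rsh ρ rm σ ϑr Rs ε rI ℓ ϑ₀ Rg sb dI dB lam aHi Λ θ s)
    (h : OffTubeGapMinP ϑc ϑ ϑp r rΘ q rsh ρ rm σ ϑr Rs ε rI ℓ Rg sb dI dB sb₁ dI₁ dB₁ g₀ aHi Λ θ s) :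
    OffTubeGapP ϑc ϑ ϑp r rΘ q rsh ρ rm σ ϑr Rs ε rI ℓ Rg sb dI dB sb₁ dI₁ dB₁ g₀ aHi Λ θ s := by
  intro δ hδ a ha S hS hsum hgood L w hLw x₀ K hKS hKq hmild hcool n xf hxf hrange L' w' U t hC lab hlab hoff y hyT hyinj hydisj hcrit htame
  have hfree := hR δ hδ a ha S hS hsum hgood L w hLw x₀ K hKS hKq hmild hcool n xf hxf hrange L' w' U t hC lab hlab
  have hyO : y ∈ bondTube (S \ coreOf S K ρ) Rg sb dI dB (fun i => lab (xf i)) := bondTube_mono hsb hdI hdB hyT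
  obtain ⟨φ, hφ, hconv⟩ := hX1 δ hδ a ha S hS hsum hgood L w hLw x₀ K hKS hKq hmild hcool n xf hxf hrange L' w' U t hC lab hlab hfree y hyO
  have hφ0 : φ = 0 := hφ.unique hcrit
  have hmin : ∀ z ∈ bondTube (S \ coreOf S K ρ) Rg sb₁ dI₁ dB₁ (fun i => lab (xf i)),
      clampedEnergy (S \ coreOf S K ρ) y ≤ clampedEnergy (S \ coreOf S K ρ) z := fun z hz => by
    have hz' := hconv z (bondTube_mono hsb hdI hdB hz)
    rw [hφ0, zero_apply] at hz'
    have hs : 0 ≤ lam * ∑ i, dist (y i) (z i) ^ 2 := mul_nonneg hlam (Finset.sum_nonneg fun i _ => by positivity)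
    linarith
  exact h δ hδ a ha S hS hsum hgood L w hLw x₀ K hKS hKq hmild hcool n xf hxf hrange L' w' U t hC lab hlab hoff y hyT hyinj hydisj hcrit htame hmin

/-- ★★★ **WEAKER-THAN CERTIFICATE (PROVED): (RDᴸ)(Rd, D₀) ∧ (DWᴹ)(Rd, cE, σ₀) ⟹ (OGᴹ)(cE·D₀ − σ₀)**, `0 ≤ cE` — the Min-copy of tree ZZZS `offTubeGapP_of_deficit`:
at the minimiser, the well gives `E y + cE·deficit(V) − σ₀ ≤ E xf` for some proper `V`, the floor gives `D₀ ≤ deficit(V)` off the tube. [this file, g92] -/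
theorem offTubeGapMinP_of_deficitWellMin {ϑc ϑ ϑp r rΘ q rsh ρ rm σ ϑr Rs ε rI ℓ Rg sb dI dB sb₁ dI₁ dB₁ Rd D₀ cE σ₀ aHi Λ θ s : ℝ} (hcE : 0 ≤ cE)
    (hRD : OffTubeDeficitFloorP ϑc ϑp r rΘ q rsh ρ rm σ ϑr Rs ε rI ℓ Rg sb dI dB sb₁ dI₁ dB₁ Rd D₀ aHi Λ θ s)
    (hDW : DeficitWellMinP ϑc ϑ ϑp r rΘ q rsh ρ rm σ ϑr Rs ε rI ℓ Rg sb₁ dI₁ dB₁ Rd cE σ₀ aHi Λ θ s) :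
    OffTubeGapMinP ϑc ϑ ϑp r rΘ q rsh ρ rm σ ϑr Rs ε rI ℓ Rg sb dI dB sb₁ dI₁ dB₁ (cE * D₀ - σ₀) aHi Λ θ s := by
  intro δ hδ a ha S hS hsum hgood L w hLw x₀ K hKS hKq hmild hcool n xf hxf hrange L' w' U t hC lab hlab hoff y hyT hyinj hydisj hcrit htame hmin
  obtain ⟨V, hV, hE⟩ := hDW δ hδ a ha S hS hsum hgood L w hLw x₀ K hKS hKq hmild hcool n xf hxf hrange L' w' U t hC lab hlab y hyT hyinj hydisj hcrit
    htame hmin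
  have hD := hRD δ hδ a ha S hS hsum hgood L w hLw x₀ K hKS hKq hmild hcool n xf hxf hrange L' w' U t hC lab hlab hoff y hyT V hV
  nlinarith [mul_le_mul_of_nonneg_left hD hcE]

/-- ★★★ **THE RESIDUAL OF RECORD IMPLIES THE NEW ONE (PROVED), every `σ ≥ 1/2`, every tameness level `ϑ`**: at the record radii (`Rg = Rd = 121/25`, outer tube
`(249/5000, 249/5000, 21/50)`, inner radii `4sb₁, 4dI₁ ≤ 249/5000`, `0 ≤ sb₁, dB₁`), (DWᴹ)(σ)(cE > 0, σ₀ = 0) ⟹ `∃ g₀ > 0`, (OGᴹ)(σ)(g₀) — with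
`g₀ = cE·cR·10⁻⁴`, (RGᴸ)(σ)(cR) from tree ZZZXB/ZZZYB (`deficitRigidityP_of_coreLightLabelTree` ∘ `coreLightLabelTreeP_sigma`) and (TGᴸ)(σ)(10⁻⁴) from tree
ZZZYA (`offTubeRigidGapP_fat_sigma` ∘ `offTubeBondExitP_fat_sigma` ∘ `offTubeBulkExitP_fat_sigma`).  The converse is not claimed. [this file, g92] -/
theorem exists_offTubeGapMinP_sigma_of_deficitWellMin {σ ϑc ϑ sb₁ dI₁ dB₁ cE : ℝ} (hσ : 1 / 2 ≤ σ) (hcE : 0 < cE) (hsb : 4 * sb₁ ≤ 249 / 5000)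
    (hdI : 4 * dI₁ ≤ 249 / 5000) (hsb₀ : 0 ≤ sb₁) (hdB₀ : 0 ≤ dB₁)
    (hDW : DeficitWellMinP ϑc ϑ (1 / 10) 8 (145 / 16) 4 12 16 16 σ (1 / 10000) 5 (1 / 10000) 10 (43 / 2) (121 / 25) sb₁ dI₁ dB₁ (121 / 25) cE 0 1 2
      (1 / 16) (1 / 50)) :
    ∃ g₀ : ℝ, 0 < g₀ ∧ OffTubeGapMinP ϑc ϑ (1 / 10) 8 (145 / 16) 4 12 16 16 σ (1 / 10000) 5 (1 / 10000) 10 (43 / 2) (121 / 25) (249 / 5000) (249 / 5000)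
      (21 / 50) sb₁ dI₁ dB₁ g₀ 1 2 (1 / 16) (1 / 50) := by
  have hN : 0 < (130925 : ℕ) := by norm_num
  have hH : 0 < (19614 : ℕ) := by norm_num
  have hΔ : (0 : ℝ) ≤ 4746588 / 25 := by norm_num
  have hsμ : sb₁ < 3 / 10 := by linarith
  have hcR := labelChainRigidityConst_pos (N₀ := 130925) (H₀ := 19614) (ΔC := 4746588 / 25) (dB := dB₁) hN hH hΔ hdB₀ hsμ
  have hRG := deficitRigidityP_of_coreLightLabelTree (dI₁ := dI₁) hN hH hΔ le_rfl hsb₀ hsμ hdB₀ (coreLightLabelTreeP_sigma hσ ϑc)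
  have hTG := offTubeRigidGapP_fat_sigma (σ := σ) (ϑc := ϑc) (dB₁ := dB₁) hsb hdI (offTubeBondExitP_fat_sigma (offTubeBulkExitP_fat_sigma hσ))
  have h := offTubeGapMinP_of_deficitWellMin hcE.le (offTubeDeficitFloorP_of_rigidity hcR.le hRG hTG) hDW
  rw [sub_zero] at h
  exact ⟨_, mul_pos hcE (mul_pos hcR (by norm_num)), h⟩

end Glue

section Door

/-- ★★★★ **THE NEW DOOR W2g(σ) (PROVED), every `σ > 21/25`: `[MCMC♮](ϑc) ⟸ (SC♮)(σ) ∧ (X1ᴸ)(σ)(lam > 0) ∧ (X2ᴸ)(σ) ∧ (OGᴹ)(σ)(g₀ > 0)`** — tree ZZZYB's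
W2c(σ) with the energetic entrance moved from (RGᴸ) ∧ (DWᴹ) to the off-tube gap about the minimiser: `mildCoherentMoatCorePG_OM_sigma` ∘ `minInLabelTubeP_of_gap`
∘ (`labelTubeFillingP_of_loadPath`, `offTubeGapP_of_min`), reference (XRᴸ)(σ) by `labelTubeReferenceP_sigma`. [this file, g92] -/
theorem mildCoherentMoatCorePG_W2g_sigma {σ ϑc sb₁ dI₁ dB₁ lam g₀ : ℝ} (hσ : 21 / 25 < σ) (hlam : 0 < lam) (hg₀ : 0 < g₀) (hsb : 4 * sb₁ ≤ 249 / 5000)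
    (hdI : 4 * dI₁ ≤ 249 / 5000) (hdB : dB₁ ≤ 2 / 5) (hsb₀ : 0 ≤ sb₁) (hdI₀ : 0 ≤ dI₁) (hdB₀ : 0 ≤ dB₁)
    (hSC : CoherentZoneShadowCrystalP ϑc (1 / 10) 8 4 12 16 σ (1 / 10000) 5 (1 / 10000) 10 (43 / 2) 1 2 (1 / 16) (1 / 50))
    (hX1 : LabelTubeConvexityP ϑc tameRadius (1 / 10) 8 (145 / 16) 4 12 16 16 σ (1 / 10000) 5 (1 / 10000) 10 (43 / 2) (1 / 5000) (121 / 25)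
      (249 / 5000) (249 / 5000) (21 / 50) lam 1 2 (1 / 16) (1 / 50))
    (hX2 : LabelLoadedTubeAprioriP ϑc tameRadius (1 / 10) 8 (145 / 16) 4 12 16 16 σ (1 / 10000) 5 (1 / 10000) 10 (43 / 2) (1 / 5000)
      (121 / 25) (249 / 5000) (249 / 5000) (21 / 50) sb₁ dI₁ dB₁ 1 2 (1 / 16) (1 / 50))
    (hOG : OffTubeGapMinP ϑc tameRadius (1 / 10) 8 (145 / 16) 4 12 16 16 σ (1 / 10000) 5 (1 / 10000) 10 (43 / 2) (121 / 25) (249 / 5000) (249 / 5000)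
      (21 / 50) sb₁ dI₁ dB₁ g₀ 1 2 (1 / 16) (1 / 50)) :
    MildCoherentMoatCorePG ϑc tameRadius (1 / 10) 8 4 12 16 1 2 (1 / 16) (1 / 50) :=
  have hσε : 2 * (1 / 10000 : ℝ) < σ := by linarith
  have h2dB : 2 * (21 / 50 : ℝ) < σ := by linarith
  have hdIσ : (249 / 5000 : ℝ) + 1 / 10000 < σ := by linarith
  have hR := labelTubeReferenceP_sigma ϑc (ϑ := tameRadius) (ϑ₀ := 1 / 5000) (sb := 249 / 5000) hσε (by norm_num) h2dB (by norm_num) (by norm_num)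
    (by norm_num) hdIσ (by norm_num) (by rw [max_self]; norm_num [tameRadius])
  mildCoherentMoatCorePG_OM_sigma (ϑ₀ := 1 / 5000) hσε (by norm_num) h2dB (by norm_num) (by norm_num) (by norm_num) hdIσ (by norm_num)
    (by rw [max_self]; norm_num [tameRadius]) hSC
    (minInLabelTubeP_of_gap hg₀ (labelTubeFillingP_of_loadPath hlam (by linarith) (by linarith) (by linarith) hsb₀ hdI₀ hdB₀ hR hX1 hX2)
      (offTubeGapP_of_min hlam.le (by linarith) (by linarith) (by linarith) hR hX1 hOG))

/-- ★★★★ **THE DOOR OF NODE 92 (PROVED) — `σ′ = 27/32`, coherence `ϑc ≤ ϑ₀ := 5·10⁻¹²`: `[MCMC♮](ϑc) ⟸ (X1ᴸ′)(lam > 0) ∧ (X2ᴸ′) ∧ (OGᴹ′)(g₀ > 0)`**, the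
kinematic leaf (SC♮′) discharged by tree ZZZYF `coherentZoneShadowCrystalP_of_le`.  RESIDUAL after this node: (X1ᴸ′), (X2ᴸ′) [ANALYTIC, unchanged] and
(OGᴹ′) [ENERGETIC, weaker than (DWᴹ′)] — or, one layer down, (OGˢ′) ∧ (OGʰ′) (`mildCoherentMoatCorePG_W2g_softHard`). [this file, g92] -/
theorem mildCoherentMoatCorePG_W2g {ϑc sb₁ dI₁ dB₁ lam g₀ : ℝ} (hϑc : ϑc ≤ 1 / 200000000000) (hlam : 0 < lam) (hg₀ : 0 < g₀)
    (hsb : 4 * sb₁ ≤ 249 / 5000) (hdI : 4 * dI₁ ≤ 249 / 5000) (hdB : dB₁ ≤ 2 / 5) (hsb₀ : 0 ≤ sb₁) (hdI₀ : 0 ≤ dI₁) (hdB₀ : 0 ≤ dB₁)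
    (hX1 : LabelTubeConvexityP ϑc tameRadius (1 / 10) 8 (145 / 16) 4 12 16 16 (27 / 32) (1 / 10000) 5 (1 / 10000) 10 (43 / 2) (1 / 5000) (121 / 25)
      (249 / 5000) (249 / 5000) (21 / 50) lam 1 2 (1 / 16) (1 / 50))
    (hX2 : LabelLoadedTubeAprioriP ϑc tameRadius (1 / 10) 8 (145 / 16) 4 12 16 16 (27 / 32) (1 / 10000) 5 (1 / 10000) 10 (43 / 2) (1 / 5000)
      (121 / 25) (249 / 5000) (249 / 5000) (21 / 50) sb₁ dI₁ dB₁ 1 2 (1 / 16) (1 / 50))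
    (hOG : OffTubeGapMinP ϑc tameRadius (1 / 10) 8 (145 / 16) 4 12 16 16 (27 / 32) (1 / 10000) 5 (1 / 10000) 10 (43 / 2) (121 / 25) (249 / 5000)
      (249 / 5000) (21 / 50) sb₁ dI₁ dB₁ g₀ 1 2 (1 / 16) (1 / 50)) :
    MildCoherentMoatCorePG ϑc tameRadius (1 / 10) 8 4 12 16 1 2 (1 / 16) (1 / 50) :=
  mildCoherentMoatCorePG_W2g_sigma (by norm_num) hlam hg₀ hsb hdI hdB hsb₀ hdI₀ hdB₀ (coherentZoneShadowCrystalP_of_le hϑc) hX1 hX2 hOG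

/-- ★★★ **THE DOOR ON THE SPLIT (PROVED)**: `[MCMC♮](ϑc) ⟸ ϑc ≤ 5·10⁻¹² ∧ (X1ᴸ′)(lam > 0) ∧ (X2ᴸ′) ∧ (OGˢ′)(Rd, τ, g₀) ∧ (OGʰ′)(Rd, τ, g₀)`, `0 < g₀`, for ANY
split scale `(Rd, τ)` — via `offTubeGapMinP_iff_softHard`. [this file, g92] -/
theorem mildCoherentMoatCorePG_W2g_softHard {ϑc sb₁ dI₁ dB₁ lam Rd τ g₀ : ℝ} (hϑc : ϑc ≤ 1 / 200000000000) (hlam : 0 < lam) (hg₀ : 0 < g₀)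
    (hsb : 4 * sb₁ ≤ 249 / 5000) (hdI : 4 * dI₁ ≤ 249 / 5000) (hdB : dB₁ ≤ 2 / 5) (hsb₀ : 0 ≤ sb₁) (hdI₀ : 0 ≤ dI₁) (hdB₀ : 0 ≤ dB₁)
    (hX1 : LabelTubeConvexityP ϑc tameRadius (1 / 10) 8 (145 / 16) 4 12 16 16 (27 / 32) (1 / 10000) 5 (1 / 10000) 10 (43 / 2) (1 / 5000) (121 / 25)
      (249 / 5000) (249 / 5000) (21 / 50) lam 1 2 (1 / 16) (1 / 50))
    (hX2 : LabelLoadedTubeAprioriP ϑc tameRadius (1 / 10) 8 (145 / 16) 4 12 16 16 (27 / 32) (1 / 10000) 5 (1 / 10000) 10 (43 / 2) (1 / 5000)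
      (121 / 25) (249 / 5000) (249 / 5000) (21 / 50) sb₁ dI₁ dB₁ 1 2 (1 / 16) (1 / 50))
    (hS : OffTubeSoftGapMinP ϑc tameRadius (1 / 10) 8 (145 / 16) 4 12 16 16 (27 / 32) (1 / 10000) 5 (1 / 10000) 10 (43 / 2) (121 / 25) (249 / 5000)
      (249 / 5000) (21 / 50) sb₁ dI₁ dB₁ Rd τ g₀ 1 2 (1 / 16) (1 / 50))
    (hH : OffTubeHardGapMinP ϑc tameRadius (1 / 10) 8 (145 / 16) 4 12 16 16 (27 / 32) (1 / 10000) 5 (1 / 10000) 10 (43 / 2) (121 / 25) (249 / 5000)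
      (249 / 5000) (21 / 50) sb₁ dI₁ dB₁ Rd τ g₀ 1 2 (1 / 16) (1 / 50)) :
    MildCoherentMoatCorePG ϑc tameRadius (1 / 10) 8 4 12 16 1 2 (1 / 16) (1 / 50) :=
  mildCoherentMoatCorePG_W2g hϑc hlam hg₀ hsb hdI hdB hsb₀ hdI₀ hdB₀ hX1 hX2 (offTubeGapMinP_iff_softHard.2 ⟨hS, hH⟩)

/-- ★★★ **THE HAND-OVER SHAPE (PROVED)**: the three residual leaves AT `ϑc := ϑ₀ = 5·10⁻¹²` give `∃ ϑm > 0, [MCMC♮](ϑm)` — the form `MildColdSereneDocket`'s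
coherent branch consumes (as tree ZZZYF `exists_mildCoherentMoatCorePG_W2f`). [this file, g92] -/
theorem exists_mildCoherentMoatCorePG_W2g {sb₁ dI₁ dB₁ lam g₀ : ℝ} (hlam : 0 < lam) (hg₀ : 0 < g₀) (hsb : 4 * sb₁ ≤ 249 / 5000)
    (hdI : 4 * dI₁ ≤ 249 / 5000) (hdB : dB₁ ≤ 2 / 5) (hsb₀ : 0 ≤ sb₁) (hdI₀ : 0 ≤ dI₁) (hdB₀ : 0 ≤ dB₁)
    (hX1 : LabelTubeConvexityP (1 / 200000000000) tameRadius (1 / 10) 8 (145 / 16) 4 12 16 16 (27 / 32) (1 / 10000) 5 (1 / 10000) 10 (43 / 2)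
      (1 / 5000) (121 / 25) (249 / 5000) (249 / 5000) (21 / 50) lam 1 2 (1 / 16) (1 / 50))
    (hX2 : LabelLoadedTubeAprioriP (1 / 200000000000) tameRadius (1 / 10) 8 (145 / 16) 4 12 16 16 (27 / 32) (1 / 10000) 5 (1 / 10000) 10 (43 / 2)
      (1 / 5000) (121 / 25) (249 / 5000) (249 / 5000) (21 / 50) sb₁ dI₁ dB₁ 1 2 (1 / 16) (1 / 50))
    (hOG : OffTubeGapMinP (1 / 200000000000) tameRadius (1 / 10) 8 (145 / 16) 4 12 16 16 (27 / 32) (1 / 10000) 5 (1 / 10000) 10 (43 / 2) (121 / 25)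
      (249 / 5000) (249 / 5000) (21 / 50) sb₁ dI₁ dB₁ g₀ 1 2 (1 / 16) (1 / 50)) :
    ∃ ϑm : ℝ, 0 < ϑm ∧ MildCoherentMoatCorePG ϑm tameRadius (1 / 10) 8 4 12 16 1 2 (1 / 16) (1 / 50) :=
  ⟨1 / 200000000000, by norm_num, mildCoherentMoatCorePG_W2g le_rfl hlam hg₀ hsb hdI hdB hsb₀ hdI₀ hdB₀ hX1 hX2 hOG⟩

/-- ★★★ **CONSISTENCY (PROVED): THE DOOR OF RECORD FACTORS THROUGH W2g** — tree ZZZYF `mildCoherentMoatCorePG_W2f`'s hypotheses re-derive `[MCMC♮](ϑc)` via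
`exists_offTubeGapMinP_sigma_of_deficitWellMin` and `mildCoherentMoatCorePG_W2g`: the old residual implies the new one, which implies the door. [this file, g92]
(LANE EDITION hand-2 g43: stated as an `example` — the statement IS the tree's `…ZZZYF.mildCoherentMoatCorePG_W2f` (gate dedup.landed); the node named it
`mildCoherentMoatCorePG_W2f_via_gap`.) -/
example {ϑc sb₁ dI₁ dB₁ lam cE : ℝ} (hϑc : ϑc ≤ 1 / 200000000000) (hlam : 0 < lam) (hcE : 0 < cE)
    (hsb : 4 * sb₁ ≤ 249 / 5000) (hdI : 4 * dI₁ ≤ 249 / 5000) (hdB : dB₁ ≤ 2 / 5) (hsb₀ : 0 ≤ sb₁) (hdI₀ : 0 ≤ dI₁) (hdB₀ : 0 ≤ dB₁)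
    (hX1 : LabelTubeConvexityP ϑc tameRadius (1 / 10) 8 (145 / 16) 4 12 16 16 (27 / 32) (1 / 10000) 5 (1 / 10000) 10 (43 / 2) (1 / 5000) (121 / 25)
      (249 / 5000) (249 / 5000) (21 / 50) lam 1 2 (1 / 16) (1 / 50))
    (hX2 : LabelLoadedTubeAprioriP ϑc tameRadius (1 / 10) 8 (145 / 16) 4 12 16 16 (27 / 32) (1 / 10000) 5 (1 / 10000) 10 (43 / 2) (1 / 5000)
      (121 / 25) (249 / 5000) (249 / 5000) (21 / 50) sb₁ dI₁ dB₁ 1 2 (1 / 16) (1 / 50))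
    (hDW : DeficitWellMinP ϑc tameRadius (1 / 10) 8 (145 / 16) 4 12 16 16 (27 / 32) (1 / 10000) 5 (1 / 10000) 10 (43 / 2) (121 / 25) sb₁ dI₁ dB₁
      (121 / 25) cE 0 1 2 (1 / 16) (1 / 50)) :
    MildCoherentMoatCorePG ϑc tameRadius (1 / 10) 8 4 12 16 1 2 (1 / 16) (1 / 50) := by
  obtain ⟨g₀, hg₀, hOG⟩ := exists_offTubeGapMinP_sigma_of_deficitWellMin (by norm_num) hcE hsb hdI hsb₀ hdB₀ hDW
  exact mildCoherentMoatCorePG_W2g hϑc hlam hg₀ hsb hdI hdB hsb₀ hdI₀ hdB₀ hX1 hX2 hOG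

end Door

end Summit.AtomisticToContinuum.Crystallization.Theorems.ChartedZeroExcessLayeredLatticeLiouville
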